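import Mathlib
import HarnessLib
import Literature.AlgebraicGeometry.Resolution.BlowupStalkEmbedding
import Literature.AlgebraicGeometry.Resolution.BlowupChartMembership
import Literature.AlgebraicGeometry.Resolution.PermissibleCentres
import Literature.AlgebraicGeometry.Resolution.QuadraticTransforms
import Summits.ResolutionOfSingularities.ResolutionOfSingularities.Theorems.WildQuotientsWildQuotientResolutionKSBlowupLocalChart

/-!
# Kollár–Szabó going down, blow-up step (K2-scheme, local structure): the local ring of the point blow-up at
# the image of the closed point of a quadratic-transform chart IS that quadratic transform
# (crux `WildQuotients.WildQuotientResolution`, stub `stub_phaseZeroHighDim`)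

Crux stmt-ResolutionOfSingularities-15640 (`WildQuotientResolution`), registered stub `stub_phaseZeroHighDim`;
programme PHASE0-KS-EIGENLINE. ✓`KSGoingDown.exists_fixedPoint_liftAction` (p828806) produces the `H`-fixed
point `x' ∈ X' = Bl_x X` as the image `φ(closed point)` of a LOCAL CHART `φ : Spec R → X'` over
`Spec R → Spec 𝒪_{X,x} → X`, where `R ⊆ Frac 𝒪_{X,x}` is a quadratic transform of (the image `S` of) `𝒪_{X,x}`
(✓`IsQuadraticTransform`). This file identifies the local ring: **`𝒪_{X',x'} ≅ R`** — so that `x'` inherits the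
algebra of `R` (regularity, dimension, residue field; hands 8-g1/9-g0: ✓`isRegularLocalRing_ofPrime_blowupRing`,
same residue field) and the construction ITERATES along towers of point blow-ups (the Kollár–Szabó fixed point
climbs the tower).

* `stalkClosedPointTo_congr` — transport of `Scheme.stalkClosedPointTo` along an equality of morphisms;
* `stalkMap_comp_stalkClosedPointTo_eq` — for `φ ≫ π = Spec ι ≫ ι_x`: `ψ ∘ π♯_{x'} = ι ∘ (𝒪_{X,π x'} ≅ 𝒪_{X,x})`
  with `ψ = stalkClosedPointTo φ : 𝒪_{X',x'} → R`;
* `stalkClosedPointTo_injective_of_isBlowup` — `ψ` is injective (every element of `𝒪_{X',x'}` is a fraction of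
  elements of `𝒪_{X,x}`, ✓`IsBlowup.stalkEmb`; `ι` injective);
* `stalkClosedPointTo_surjective_of_isQuadraticTransform` — `ψ` is surjective: `𝔪_x 𝒪_{X',x'}` is principal
  (effective Cartier), generated by the image of the element `x₀` of the chart `S[𝔪/x₀] ⊆ R` (locality of `ψ`),
  so `S[𝔪/x₀] ⊆ ψ(𝒪_{X',x'})`, and unit denominators lift to units (`ψ` local);
* `bijective_stalkClosedPointTo_of_isQuadraticTransform`, `nonempty_stalk_ringEquiv_of_isQuadraticTransform` —
  **`𝒪_{X',x'} ≃+* R`** (regularity, dimension and residue field of `x'` are then read off `R`).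

[OURS · crux stmt-ResolutionOfSingularities-15640 · helper toward `stub_phaseZeroHighDim` (local structure of the
fixed point of the abstract blow-up step of Kollár–Szabó going down; NOT a proof of the stub); folklore (Stacks
0804), counted 0; AI-level work, weaker than expert review.] [folklore]
-/

-- single-problem summit: the doubled namespace component `ResolutionOfSingularities` is forced
set_option linter.dupNamespace false

noncomputable section

open CategoryTheory CategoryTheory.Limits AlgebraicGeometry TopologicalSpace IsLocalRing
open Literature.AlgebraicGeometry.Resolution
open Scheme.IdealSheafData

namespace Summit.ResolutionOfSingularities.ResolutionOfSingularities.Theorems.WildQuotientResolution.KSGoingDown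

universe u

/-! ## Transport of `stalkClosedPointTo` and the structure map of the chart -/

/-- Transport of `Scheme.stalkClosedPointTo` along an equality of morphisms `f = g : Spec R → X`.
[folklore] -/
theorem stalkClosedPointTo_congr {X : Scheme.{u}} {R : CommRingCat.{u}} [IsLocalRing R]
    {f g : Spec R ⟶ X} (e : f = g) :
    Scheme.stalkClosedPointTo f =
      X.presheaf.stalkSpecializes (specializes_of_eq
        (congrArg (fun h : Spec R ⟶ X => h (closedPoint R)) e).symm) ≫ Scheme.stalkClosedPointTo g := by
  subst e
  simp

variable {X' X : Scheme.{u}} {π : X' ⟶ X} {x : X}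

/-- **The structure map of the chart.** If `φ : Spec R → X'` lies over `Spec R → Spec 𝒪_{X,x} → X`
(`φ ≫ π = Spec ι ≫ ι_x`, `ι` local) and `y = φ(closed point)`, then
`stalkClosedPointTo φ ∘ π♯_y = ι ∘ (𝒪_{X,π y} → 𝒪_{X,x})`, the latter being the specialization isomorphism along
`π y = x`. [folklore] -/
theorem stalkMap_comp_stalkClosedPointTo_eq {R : Type u} [CommRing R] [IsLocalRing R]
    (ι : X.presheaf.stalk x →+* R) [IsLocalHom ι] (φ : Spec (.of R) ⟶ X')
    (hφ : φ ≫ π = Spec.map (CommRingCat.ofHom ι) ≫ X.fromSpecStalk x)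
    (hxy : x ⤳ (φ ≫ π) (closedPoint (CommRingCat.of R))) :
    π.stalkMap (φ (closedPoint R)) ≫ Scheme.stalkClosedPointTo φ =
      X.presheaf.stalkSpecializes hxy ≫ CommRingCat.ofHom ι := by
  haveI : IsLocalHom (CommRingCat.ofHom ι).hom := ‹IsLocalHom ι›
  rw [← Scheme.stalkClosedPointTo_comp, stalkClosedPointTo_congr hφ]
  apply TopCat.Presheaf.stalk_hom_ext
  intro U hU
  rw [TopCat.Presheaf.germ_stalkSpecializes_assoc, Scheme.germ_stalkClosedPointTo_Spec_fromSpecStalk]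
  erw [TopCat.Presheaf.germ_stalkSpecializes_assoc]
  rfl

/-- The point of the chart lies over `x`. [folklore] -/
theorem π_apply_closedPoint_eq {R : Type u} [CommRing R] [IsLocalRing R]
    (ι : X.presheaf.stalk x →+* R) [IsLocalHom ι] (φ : Spec (.of R) ⟶ X')
    (hφ : φ ≫ π = Spec.map (CommRingCat.ofHom ι) ≫ X.fromSpecStalk x) :
    π (φ (closedPoint R)) = x := by
  rw [← Scheme.Hom.comp_apply, hφ]
  exact specMap_comp_fromSpecStalk_closedPoint ι

/-- Elementwise form of `stalkMap_comp_stalkClosedPointTo_eq`. [folklore] -/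
theorem stalkClosedPointTo_stalkMap_apply {R : Type u} [CommRing R] [IsLocalRing R]
    (ι : X.presheaf.stalk x →+* R) [IsLocalHom ι] (φ : Spec (.of R) ⟶ X')
    (hφ : φ ≫ π = Spec.map (CommRingCat.ofHom ι) ≫ X.fromSpecStalk x)
    (a : X.presheaf.stalk (π (φ (closedPoint R)))) :
    (Scheme.stalkClosedPointTo φ).hom ((π.stalkMap (φ (closedPoint R))).hom a) =
      ι ((X.presheaf.stalkSpecializes
        (specializes_of_eq (π_apply_closedPoint_eq ι φ hφ).symm)).hom a) := by
  have h := stalkMap_comp_stalkClosedPointTo_eq ι φ hφ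
    (specializes_of_eq (π_apply_closedPoint_eq ι φ hφ).symm)
  have := congrArg (fun f => f.hom a) h
  exact this

/-! ## Injectivity -/

/-- **`stalkClosedPointTo φ : 𝒪_{X',x'} → R` is injective** for a blowing up `π` of an integral locally
Noetherian `X` and a chart `φ` over an INJECTIVE `ι : 𝒪_{X,x} → R` into a domain: every `s ∈ 𝒪_{X',x'}`
satisfies `s · π♯ b = π♯ a` with `b ≠ 0` (✓`IsBlowup.stalkEmb`), so `ψ s = 0` forces `a = 0`, `s = 0`.
[cite: StacksProject, Tag 0804] -/
theorem stalkClosedPointTo_injective_of_isBlowup [IsIntegral X] [IsLocallyNoetherian X] [IsIntegral X']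
    {J : X.IdealSheafData} (hπ : IsBlowup π J) {R : Type u} [CommRing R] [IsDomain R] [IsLocalRing R]
    (ι : X.presheaf.stalk x →+* R) [IsLocalHom ι] (hιinj : Function.Injective ι)
    (φ : Spec (.of R) ⟶ X') (hφ : φ ≫ π = Spec.map (CommRingCat.ofHom ι) ≫ X.fromSpecStalk x) :
    Function.Injective (Scheme.stalkClosedPointTo φ).hom := by
  set y := φ (closedPoint R) with hy
  set ψ := (Scheme.stalkClosedPointTo φ).hom with hψ
  set T := (π.stalkMap y).hom with hT
  rw [injective_iff_map_eq_zero]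
  intro s hs
  -- `s` is a fraction `π♯ a / π♯ b`
  obtain ⟨a, b, hb, hab⟩ :=
    IsFractionRing.div_surjective (A := X.presheaf.stalk (π y)) (hπ.stalkEmb y s)
  have hb0 : b ≠ 0 := nonZeroDivisors.ne_zero hb
  have halg0 : algebraMap (X.presheaf.stalk (π y)) X.functionField b ≠ 0 := fun h =>
    hb0 ((IsFractionRing.to_map_eq_zero_iff (K := X.functionField)).mp h)
  have hsb : s * T b = T a := by
    apply hπ.stalkEmb_injective y
    rw [map_mul, hπ.stalkEmb_stalkMap, hπ.stalkEmb_stalkMap, ← hab, div_mul_cancel₀ _ halg0]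
  -- apply `ψ`: `ι (σ₀ a) = 0`, hence `a = 0`
  have hψa : ψ (T a) = 0 := by rw [← hsb, map_mul, hs, zero_mul]
  rw [hψ, hT, stalkClosedPointTo_stalkMap_apply ι φ hφ a] at hψa
  have ha0 : a = 0 := by
    have h1 := hιinj (hψa.trans (map_zero ι).symm)
    have h2 := congrArg (X.presheaf.stalkSpecializes
      (specializes_of_eq (π_apply_closedPoint_eq ι φ hφ))).hom h1
    rw [map_zero, ← CommRingCat.comp_apply, TopCat.Presheaf.stalkSpecializes_comp] at h2
    simpa using h2
  rw [ha0, map_zero] at hsb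
  have hTb : T b ≠ 0 := fun h => hb0 (hπ.stalkMap_injective y (h.trans (map_zero _).symm))
  exact (mul_eq_zero.mp hsb).resolve_right hTb

/-! ## Surjectivity for a quadratic-transform chart -/

section Surj

variable [IsIntegral X] (hx : IsClosed ({x} : Set X))

/-- An element of the image `S` of `𝒪_{X,x}` in its fraction field which lies in the maximal ideal of `S` comes
from the maximal ideal of `𝒪_{X,x}`. [folklore] -/
theorem mem_maximalIdeal_of_algebraMap_mem {A : Type u} [CommRing A] [IsDomain A] [IsLocalRing A]
    [IsLocalRing (algebraMap A (FractionRing A)).range] {a : A}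
    (ha : (⟨algebraMap A (FractionRing A) a, ⟨a, rfl⟩⟩ : (algebraMap A (FractionRing A)).range) ∈
      maximalIdeal ((algebraMap A (FractionRing A)).range)) : a ∈ maximalIdeal A := by
  rw [IsLocalRing.mem_maximalIdeal] at ha ⊢
  intro hu
  apply ha
  exact hu.map (algebraMap A (FractionRing A)).rangeRestrict

/-- Conversely, the maximal ideal of `𝒪_{X,x}` maps into the maximal ideal of its image `S`, provided `S` is local
and `S ⊆ R` is dominated by a local `R` with `ι : A → R` local. We only need the elementary direction:
`a ∈ 𝔪_A` implies `ι a` is a non-unit for a LOCAL `ι`. [folklore] -/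
theorem not_isUnit_of_mem_maximalIdeal {A R : Type u} [CommRing A] [IsLocalRing A] [CommRing R]
    [IsLocalRing R] (ι : A →+* R) [IsLocalHom ι] {a : A} (ha : a ∈ maximalIdeal A) : ¬ IsUnit (ι a) :=
  fun h => (IsLocalRing.mem_maximalIdeal _).mp ha ((isUnit_map_iff ι a).mp h)

set_option maxHeartbeats 800000 in
-- the stalk maps of the blowing up and the `Subring K` coercions elaborate large terms (cf.
-- `BlowupExceptionalGenericOrder.lean`)
/-- **`stalkClosedPointTo φ : 𝒪_{X',x'} → R` is surjective** when `R ⊆ Frac 𝒪_{X,x}` is a quadratic transform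
of the image `S` of `𝒪_{X,x}`, `ι` is the (local) inclusion and `π` is the blowing up of the reduced closed point
`{x}`: `𝔪_x 𝒪_{X',x'}` is principal (effective Cartier) and — by locality of `ψ` — generated by `π♯ x₀` for the
element `x₀` of the chart `S[𝔪/x₀] ⊆ R`; hence `S[𝔪/x₀] ⊆ ψ(𝒪_{X',x'})`, and the unit denominators of
`R = S[𝔪/x₀]_𝔫` lift to units. [cite: StacksProject, Tag 0804] -/
theorem stalkClosedPointTo_surjective_of_isQuadraticTransform [IsIntegral X']
    (hπ : IsBlowup π (vanishingIdeal ⟨{x}, hx⟩))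
    (R : Subring (FractionRing (X.presheaf.stalk x))) [IsLocalRing R]
    (hQT : IsQuadraticTransform (algebraMap (X.presheaf.stalk x) (FractionRing (X.presheaf.stalk x))).range R)
    (ι : X.presheaf.stalk x →+* R) [IsLocalHom ι]
    (hι : ∀ a, ((ι a : R) : FractionRing (X.presheaf.stalk x)) =
      algebraMap (X.presheaf.stalk x) (FractionRing (X.presheaf.stalk x)) a)
    (φ : Spec (.of R) ⟶ X') (hφ : φ ≫ π = Spec.map (CommRingCat.ofHom ι) ≫ X.fromSpecStalk x) :
    Function.Surjective (Scheme.stalkClosedPointTo φ).hom := by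
  classical
  set K := FractionRing (X.presheaf.stalk x) with hK
  set S : Subring K := (algebraMap (X.presheaf.stalk x) K).range with hS
  set y := φ (closedPoint R) with hy
  set ψ := (Scheme.stalkClosedPointTo φ).hom with hψ
  set T := (π.stalkMap y).hom with hT
  have hyx : π y = x := π_apply_closedPoint_eq ι φ hφ
  -- the specialization isomorphism `σ₀ : 𝒪_{X,π y} ≅ 𝒪_{X,x}` and the structure map
  set σ₀ := (X.presheaf.stalkSpecializes (specializes_of_eq hyx.symm)).hom with hσ₀
  set σ₁ := (X.presheaf.stalkSpecializes (specializes_of_eq hyx)).hom with hσ₁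
  have hσ₁₀ : ∀ a, σ₁ (σ₀ a) = a := fun a => by
    rw [hσ₀, hσ₁, ← CommRingCat.comp_apply, TopCat.Presheaf.stalkSpecializes_comp]
    simp
  have hσ₀₁ : ∀ a, σ₀ (σ₁ a) = a := fun a => by
    rw [hσ₀, hσ₁, ← CommRingCat.comp_apply, TopCat.Presheaf.stalkSpecializes_comp]
    simp
  have hcomp : ∀ a, ψ (T a) = ι (σ₀ a) := fun a => stalkClosedPointTo_stalkMap_apply ι φ hφ a
  have hcomp' : ∀ a, ψ (T (σ₁ a)) = ι a := fun a => by rw [hcomp, hσ₀₁]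
  -- unpack the quadratic transform: the chart element `x₀`
  obtain ⟨hSloc, xK, hxK𝔪, hxK0, -, hBle, hfrac, hdom⟩ := hQT
  obtain ⟨a₀, ha₀⟩ : ∃ a₀ : X.presheaf.stalk x, algebraMap _ K a₀ = (xK : K) := xK.2
  have ha₀𝔪 : a₀ ∈ maximalIdeal (X.presheaf.stalk x) := by
    apply mem_maximalIdeal_of_algebraMap_mem
    have : (⟨algebraMap _ K a₀, ⟨a₀, rfl⟩⟩ : S) = xK := Subtype.ext ha₀
    rw [this]
    exact hxK𝔪
  have hxK0' : (xK : K) ≠ 0 := fun h => hxK0 (Subtype.ext h)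
  have hSR : S ≤ R := (le_blowupRing S (xK : K)).trans hBle
  -- `tR = ι a₀`, the chart element read in `R`
  set tR : R := ι a₀ with htR
  have htRK : (tR : K) = (xK : K) := by rw [htR, hι, ha₀]
  have htR0 : tR ≠ 0 := fun h => hxK0' (by rw [← htRK, h]; rfl)
  -- `𝔪_x · R = tR · R`
  have hmap : (maximalIdeal (X.presheaf.stalk x)).map ι = Ideal.span {tR} := by
    apply le_antisymm
    · refine (Ideal.map_le_iff_le_comap).mpr fun m hm => ?_
      have hmS : (⟨algebraMap _ K m, ⟨m, rfl⟩⟩ : S) ∈ maximalIdeal S := by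
        rw [IsLocalRing.mem_maximalIdeal]
        intro hu
        obtain ⟨h0, hinv⟩ := (isUnit_subring_iff_inv_mem _).mp hu
        have hinvR : (algebraMap _ K m)⁻¹ ∈ R := hSR hinv
        have hιm : ((ι m : R) : K) = algebraMap _ K m := hι m
        have : IsUnit (ι m) := (isUnit_subring_iff_inv_mem _).mpr ⟨by rw [hιm]; exact h0, by
          rw [hιm]; exact hinvR⟩
        exact not_isUnit_of_mem_maximalIdeal ι hm this
      have hq : algebraMap _ K m / (xK : K) ∈ R := hBle (div_mem_blowupRing _ hmS)
      rw [Ideal.mem_comap, Ideal.mem_span_singleton']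
      refine ⟨⟨_, hq⟩, Subtype.ext ?_⟩
      change algebraMap _ K m / (xK : K) * (tR : K) = ((ι m : R) : K)
      rw [htRK, hι, div_mul_cancel₀ _ hxK0']
    · rw [Ideal.span_le, Set.singleton_subset_iff]
      exact Ideal.mem_map_of_mem ι ha₀𝔪
  -- `𝔪_{π y} 𝒪_{X',y}` is principal, generated by `T (σ₁ a₀)`
  obtain ⟨g, hg0, hg⟩ := hπ.isEffectiveCartier.exists_stalkIdeal_eq_span y
  have hstalk : stalkIdeal (vanishingIdeal ⟨{x}, hx⟩) (π y) = maximalIdeal _ := by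
    have : ∀ z (hz : z = x), stalkIdeal (vanishingIdeal ⟨{x}, hx⟩) z = maximalIdeal _ := by
      rintro z rfl; exact stalkIdeal_vanishingIdeal_singleton hx
    exact this _ hyx
  rw [stalkIdeal_comap_eq_map, hstalk] at hg
  -- images under `ψ`
  have hψmap : ((maximalIdeal (X.presheaf.stalk (π y))).map T).map ψ = Ideal.span {tR} := by
    rw [← hmap, Ideal.map_map]
    apply le_antisymm
    · refine (Ideal.map_le_iff_le_comap).mpr fun m hm => ?_
      rw [Ideal.mem_comap, RingHom.comp_apply, hcomp]
      refine Ideal.mem_map_of_mem ι ?_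
      have h1 : ¬ IsUnit (σ₀ m) := fun hu => (IsLocalRing.mem_maximalIdeal _).mp hm (by
        have := hu.map σ₁; rwa [hσ₁₀] at this)
      exact (IsLocalRing.mem_maximalIdeal _).mpr h1
    · refine (Ideal.map_le_iff_le_comap).mpr fun m hm => ?_
      rw [Ideal.mem_comap, ← hcomp' m]
      have h1 : ¬ IsUnit (σ₁ m) := fun hu => (IsLocalRing.mem_maximalIdeal _).mp hm (by
        have := hu.map σ₀; rwa [hσ₀₁] at this)
      exact Ideal.mem_map_of_mem (ψ.comp T) ((IsLocalRing.mem_maximalIdeal _).mpr h1)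
  rw [hg, Ideal.map_span, Set.image_singleton] at hψmap
  -- `T (σ₁ a₀) = g * w` with `ψ w` a unit, hence `w` a unit
  have ha₀T : T (σ₁ a₀) ∈ Ideal.span {g} := by
    rw [← hg]
    refine Ideal.mem_map_of_mem _ ?_
    have h1 : ¬ IsUnit (σ₁ a₀) := fun hu => (IsLocalRing.mem_maximalIdeal _).mp ha₀𝔪 (by
      have := hu.map σ₀; rwa [hσ₀₁] at this)
    exact (IsLocalRing.mem_maximalIdeal _).mpr h1
  obtain ⟨w, hw⟩ := Ideal.mem_span_singleton'.mp ha₀T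
  have hψg : ψ g ∈ Ideal.span {tR} := hψmap ▸ Ideal.subset_span rfl
  obtain ⟨v, hv⟩ := Ideal.mem_span_singleton'.mp hψg
  have hwu : IsUnit w := by
    have h1 : tR = v * ψ w * tR := by
      have := congrArg ψ hw
      rw [map_mul, hcomp', ← hv] at this
      -- this : ψ w * (v * tR) = tR
      linear_combination (-1 : R) * this
    have h2 : v * ψ w = 1 := by
      have h3 : (v * ψ w - 1) * tR = 0 := by linear_combination (-1 : R) * h1
      rcases mul_eq_zero.mp h3 with h | h
      · exact (sub_eq_zero.mp h)
      · exact absurd h htR0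
    have hψw : IsUnit (ψ w) := IsUnit.of_mul_eq_one_right v h2
    exact (isUnit_map_iff ψ w).mp hψw
  -- every `m ∈ 𝔪_{π y}` is `T(σ₁ a₀) · M'`
  have hdiv : ∀ m ∈ maximalIdeal (X.presheaf.stalk x),
      ∃ M', T (σ₁ m) = T (σ₁ a₀) * M' := by
    intro m hm
    have h1 : T (σ₁ m) ∈ Ideal.span {g} := by
      rw [← hg]
      refine Ideal.mem_map_of_mem _ ?_
      have h1 : ¬ IsUnit (σ₁ m) := fun hu => (IsLocalRing.mem_maximalIdeal _).mp hm (by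
        have := hu.map σ₀; rwa [hσ₀₁] at this)
      exact (IsLocalRing.mem_maximalIdeal _).mpr h1
    obtain ⟨c, hc⟩ := Ideal.mem_span_singleton'.mp h1
    refine ⟨c * ↑(hwu.unit⁻¹), ?_⟩
    rw [← hw, ← hc]
    have : w * ↑(hwu.unit⁻¹) = 1 := hwu.mul_val_inv
    linear_combination (-(c * g)) * this
  -- the image of `ψ` read in `K` contains the chart `S[𝔪/x₀]`
  let Q : Subring K := (ψ.range).map R.subtype
  have hQ : ∀ z : K, z ∈ Q ↔ ∃ Z, ((ψ Z : R) : K) = z := by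
    intro z
    simp only [Q, Subring.mem_map, RingHom.mem_range, Subring.coe_subtype]
    constructor
    · rintro ⟨r, ⟨Z, rfl⟩, rfl⟩; exact ⟨Z, rfl⟩
    · rintro ⟨Z, hZ⟩; exact ⟨ψ Z, ⟨Z, rfl⟩, hZ⟩
  have hBQ : blowupRing S (xK : K) ≤ Q := by
    refine Subring.closure_le.mpr ?_
    rintro z (⟨a, rfl⟩ | ⟨m, hm, rfl⟩)
    · exact (hQ _).mpr ⟨T (σ₁ a), by rw [hcomp', hι]⟩
    · obtain ⟨m₀, hm₀⟩ : ∃ m₀ : X.presheaf.stalk x, algebraMap _ K m₀ = (m : K) := m.2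
      have hm₀𝔪 : m₀ ∈ maximalIdeal (X.presheaf.stalk x) := by
        apply mem_maximalIdeal_of_algebraMap_mem
        have : (⟨algebraMap _ K m₀, ⟨m₀, rfl⟩⟩ : S) = m := Subtype.ext hm₀
        rw [this]
        exact hm
      obtain ⟨M', hM'⟩ := hdiv m₀ hm₀𝔪
      refine (hQ _).mpr ⟨M', ?_⟩
      have h1 : ψ (T (σ₁ m₀)) = tR * ψ M' := by rw [hM', map_mul, hcomp' a₀]
      rw [hcomp'] at h1
      have h2 : ((ι m₀ : R) : K) = (tR : K) * ((ψ M' : R) : K) := by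
        rw [h1]; rfl
      rw [hι, hm₀, htRK] at h2
      change ((ψ M' : R) : K) = ((m : S) : K) / (xK : K)
      rw [eq_div_iff hxK0', mul_comm, ← h2]
  -- conclusion
  intro r
  obtain ⟨a, haB, b, hbB, hbinv, hrab⟩ := hfrac r r.2
  obtain ⟨A, hA⟩ := (hQ a).mp (hBQ haB)
  obtain ⟨B, hB⟩ := (hQ b).mp (hBQ hbB)
  by_cases hb0 : b = 0
  · refine ⟨0, Subtype.ext ?_⟩
    rw [map_zero, hrab, hb0, div_zero]
    rfl
  · have hbu : IsUnit (ψ B) := (isUnit_subring_iff_inv_mem _).mpr ⟨by rw [hB]; exact hb0, by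
      rw [hB]; exact hbinv⟩
    have hBu : IsUnit B := (isUnit_map_iff ψ B).mp hbu
    refine ⟨A * ↑(hBu.unit⁻¹), Subtype.ext ?_⟩
    have hinv : ψ ↑(hBu.unit⁻¹) * ψ B = 1 := by
      rw [← map_mul, IsUnit.val_inv_mul, map_one]
    have hinvK : ((ψ ↑(hBu.unit⁻¹) : R) : K) = b⁻¹ := by
      have := congrArg (fun r : R => (r : K)) hinv
      simp only [Subring.coe_mul, Subring.coe_one, hB] at this
      exact eq_inv_of_mul_eq_one_left this
    rw [map_mul, Subring.coe_mul, hA, hinvK, hrab, div_eq_mul_inv]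

end Surj

/-! ## The identification and its consequences -/

/-- **`𝒪_{X',x'} ≅ R`**: for the blowing up `π : X' → X` of an integral locally Noetherian scheme along the
reduced closed point `{x}`, a quadratic transform `R ⊆ Frac 𝒪_{X,x}` of the image of `𝒪_{X,x}` with its local
inclusion `ι`, and a chart `φ : Spec R → X'` over `Spec R → Spec 𝒪_{X,x} → X`, the local ring of `X'` at
`x' = φ(closed point)` is isomorphic to `R` (via `stalkClosedPointTo φ`, which is bijective).
[cite: StacksProject, Tag 0804] -/
theorem bijective_stalkClosedPointTo_of_isQuadraticTransform [IsIntegral X] [IsLocallyNoetherian X]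
    [IsIntegral X'] (hx : IsClosed ({x} : Set X)) (hπ : IsBlowup π (vanishingIdeal ⟨{x}, hx⟩))
    (R : Subring (FractionRing (X.presheaf.stalk x))) [IsLocalRing R]
    (hQT : IsQuadraticTransform (algebraMap (X.presheaf.stalk x) (FractionRing (X.presheaf.stalk x))).range R)
    (ι : X.presheaf.stalk x →+* R) [IsLocalHom ι]
    (hι : ∀ a, ((ι a : R) : FractionRing (X.presheaf.stalk x)) =
      algebraMap (X.presheaf.stalk x) (FractionRing (X.presheaf.stalk x)) a)
    (φ : Spec (.of R) ⟶ X') (hφ : φ ≫ π = Spec.map (CommRingCat.ofHom ι) ≫ X.fromSpecStalk x) :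
    Function.Bijective (Scheme.stalkClosedPointTo φ).hom := by
  have hιinj : Function.Injective ι := fun a b h => by
    apply IsFractionRing.injective (X.presheaf.stalk x) (FractionRing (X.presheaf.stalk x))
    rw [← hι, ← hι, h]
  exact ⟨stalkClosedPointTo_injective_of_isBlowup hπ ι hιinj φ hφ,
    stalkClosedPointTo_surjective_of_isQuadraticTransform hx hπ R hQT ι hι φ hφ⟩

/-- **`𝒪_{X',x'} ≃+* R`** at the point `x' = φ(closed point)` of the chart. [cite: StacksProject, Tag 0804] -/
theorem nonempty_stalk_ringEquiv_of_isQuadraticTransform [IsIntegral X] [IsLocallyNoetherian X]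
    [IsIntegral X'] (hx : IsClosed ({x} : Set X)) (hπ : IsBlowup π (vanishingIdeal ⟨{x}, hx⟩))
    (R : Subring (FractionRing (X.presheaf.stalk x))) [IsLocalRing R]
    (hQT : IsQuadraticTransform (algebraMap (X.presheaf.stalk x) (FractionRing (X.presheaf.stalk x))).range R)
    (ι : X.presheaf.stalk x →+* R) [IsLocalHom ι]
    (hι : ∀ a, ((ι a : R) : FractionRing (X.presheaf.stalk x)) =
      algebraMap (X.presheaf.stalk x) (FractionRing (X.presheaf.stalk x)) a)
    (φ : Spec (.of R) ⟶ X') (hφ : φ ≫ π = Spec.map (CommRingCat.ofHom ι) ≫ X.fromSpecStalk x)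
    {x' : X'} (hx' : φ (closedPoint R) = x') :
    Nonempty (X'.presheaf.stalk x' ≃+* R) := by
  subst hx'
  exact ⟨RingEquiv.ofBijective (Scheme.stalkClosedPointTo φ).hom
    (bijective_stalkClosedPointTo_of_isQuadraticTransform hx hπ R hQT ι hι φ hφ)⟩

end Summit.ResolutionOfSingularities.ResolutionOfSingularities.Theorems.WildQuotientResolution.KSGoingDown

end
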